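import Summits.QuantumFields.YangMills.Theses.ParabolicTrajectory
import Literature.MathematicalPhysics.QuantumFieldTheory.LatticeGaugeProofs

/-!
# `TunedSequenceExists` — negative lemma: faithfulness of the representation is load-bearing

Crux `Summit.QuantumFields.YangMills.Theses.ParabolicTrajectory.TunedSequenceExists` (item
stmt-QuantumFields-10524; cdisprove gen 3, importable extract of § Faithful of the crux workfile
`Summits/QuantumFields/YangMills/Cruxes/TunedSequenceExists/Disproof.lean`).

With the datum `r : LatticeRep G` replaced by an arbitrary continuous unitary representation
`ρ : G →* U(N)` (injectivity dropped; the curvature observable written `actionDensity ρ`, which IS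
`r.curvature.F` definitionally — tree `ContinuumLimitOnTrajectory.Negative.curvature_F`), the crux
is false: in the trivial representation the action density is constant (`actionDensity_one`),
every connected curvature correlator vanishes
(`latticeConnectedCorr_actionDensity_one`), the window is empty for every `G`, `N`, `M`
(`window_trivialRep_false`), and the unfaithful variant of the crux fails as soon as one compact
simple Lie group exists (`tunedSequenceExists_unfaithful_false`, witness its trivial character).
"Any proof of (S) must use that `P = tr_r F²` fluctuates."
-/

noncomputable section

open Filter Topology MeasureTheory
open Literature.MathematicalPhysics.QuantumFieldTheory Literature.MathematicalPhysics.QuantumLattice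

namespace Summit.QuantumFields.YangMills.Theorems.TunedSequenceExists.Negative.UnfaithfulFalse

section Faithful

variable {G : Type} [Group G] [TopologicalSpace G] [IsTopologicalGroup G] [CompactSpace G]
  [MeasurableSpace G] [BorelSpace G] {N : ℕ}

omit [TopologicalSpace G] [IsTopologicalGroup G] [CompactSpace G] [MeasurableSpace G]
  [BorelSpace G] in
/-- In the trivial representation the action density is constant. -/
theorem actionDensity_one (U V : LGConfig 4 G) :
    actionDensity (1 : G →* Matrix (Fin N) (Fin N) ℂ) U =
      actionDensity (1 : G →* Matrix (Fin N) (Fin N) ℂ) V := by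
  simp [actionDensity, plaquetteObs]

/-- In the trivial representation every connected curvature correlator vanishes. -/
theorem latticeConnectedCorr_actionDensity_one (β : ℝ) (S : ℕ) [NeZero S] (m : ℕ) :
    latticeConnectedCorr (1 : G →* Matrix (Fin N) (Fin N) ℂ) β S
      (actionDensity (1 : G →* Matrix (Fin N) (Fin N) ℂ))
      (actionDensity (1 : G →* Matrix (Fin N) (Fin N) ℂ)) m = 0 := by
  haveI := isProbabilityMeasure_wilsonMeasure (d := 4) (L := S)
    (1 : G →* Matrix (Fin N) (Fin N) ℂ) continuous_const β
  set U₀ : LGConfig 4 G := fun _ => 1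
  have hA : ∀ V, actionDensity (1 : G →* Matrix (Fin N) (Fin N) ℂ) V =
      actionDensity (1 : G →* Matrix (Fin N) (Fin N) ℂ) U₀ := fun V => actionDensity_one V U₀
  unfold latticeConnectedCorr
  simp only [hA, integral_const, smul_eq_mul, probReal_univ]
  ring

/-- **Faithfulness of `r` is load-bearing**: with the representation datum replaced by the TRIVIAL
`N`-dimensional representation (continuous, unitary, not injective unless `G` is trivial) the window
is empty for every `G`, `N`, `M`: `N_1(k) ≡ 0`. -/
theorem window_trivialRep_false (M : ℕ) :
    ¬ (∃ θ₀ : ℝ, 0 < θ₀ ∧ ∀ θ : ℝ, 0 < θ → θ < θ₀ →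
      ∃ (sch : SpeciesScheme (YMSpecies G)) (n : ℕ → ℕ),
        (∀ k, sch.a k = ((M : ℝ) ^ n k)⁻¹) ∧ Tendsto sch.β atTop atTop ∧
        (∀ t : ℕ, 0 < t → ∃ c : ℝ, Tendsto (fun k => ((M : ℝ) ^ n k) ^ 8 *
            latticeConnectedCorr (1 : G →* Matrix (Fin N) (Fin N) ℂ) (sch.β k) (sch.side k)
              (actionDensity (1 : G →* Matrix (Fin N) (Fin N) ℂ))
              (actionDensity (1 : G →* Matrix (Fin N) (Fin N) ℂ)) (t * M ^ n k)) atTop (𝓝 c)) ∧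
        Tendsto (fun k => ((M : ℝ) ^ n k) ^ 8 *
            latticeConnectedCorr (1 : G →* Matrix (Fin N) (Fin N) ℂ) (sch.β k) (sch.side k)
              (actionDensity (1 : G →* Matrix (Fin N) (Fin N) ℂ))
              (actionDensity (1 : G →* Matrix (Fin N) (Fin N) ℂ)) (M ^ n k)) atTop (𝓝 θ)) := by
  rintro ⟨θ₀, hθ₀, h⟩
  obtain ⟨sch, n, -, -, -, hlim⟩ := h (θ₀ / 2) (by positivity) (by linarith)
  have h0 : Tendsto (fun k => ((M : ℝ) ^ n k) ^ 8 *
      latticeConnectedCorr (1 : G →* Matrix (Fin N) (Fin N) ℂ) (sch.β k) (sch.side k)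
        (actionDensity (1 : G →* Matrix (Fin N) (Fin N) ℂ))
        (actionDensity (1 : G →* Matrix (Fin N) (Fin N) ℂ)) (M ^ n k)) atTop (𝓝 0) := by
    simp only [latticeConnectedCorr_actionDensity_one, mul_zero]
    exact tendsto_const_nhds
  have := tendsto_nhds_unique hlim h0
  linarith

/-- **`TunedSequenceExists` with the faithfulness of the representation dropped is false** (the
datum `r : LatticeRep G` replaced by an arbitrary continuous unitary `ρ : G →* U(N)`, the curvature
observable being `actionDensity ρ = r.curvature.F`): witness the trivial representation of any
compact simple Lie group (stated relative to an inhabitant, e.g. `SU(2)`). -/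
theorem tunedSequenceExists_unfaithful_false {H : Type} [Group H] [TopologicalSpace H]
    [IsTopologicalGroup H] [CompactSpace H] (hH : IsCompactSimpleLieGroup H) :
    ¬ (∀ (G : Type) [Group G] [TopologicalSpace G] [IsTopologicalGroup G] [CompactSpace G],
        IsCompactSimpleLieGroup G → letI : MeasurableSpace G := borel G
        haveI : BorelSpace G := ⟨rfl⟩
        ∀ (N : ℕ) (ρ : G →* Matrix (Fin N) (Fin N) ℂ), Continuous ρ →
          (∀ g, ρ g ∈ Matrix.unitaryGroup (Fin N) ℂ) → ∀ (M : ℕ), 2 ≤ M →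
          ∃ θ₀ : ℝ, 0 < θ₀ ∧ ∀ θ : ℝ, 0 < θ → θ < θ₀ →
            ∃ (sch : SpeciesScheme (YMSpecies G)) (n : ℕ → ℕ),
              (∀ k, sch.a k = ((M : ℝ) ^ n k)⁻¹) ∧ Tendsto sch.β atTop atTop ∧
              (∀ t : ℕ, 0 < t → ∃ c : ℝ, Tendsto (fun k => ((M : ℝ) ^ n k) ^ 8 *
                  latticeConnectedCorr ρ (sch.β k) (sch.side k) (actionDensity ρ)
                    (actionDensity ρ) (t * M ^ n k)) atTop (𝓝 c)) ∧
              Tendsto (fun k => ((M : ℝ) ^ n k) ^ 8 *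
                  latticeConnectedCorr ρ (sch.β k) (sch.side k) (actionDensity ρ)
                    (actionDensity ρ) (M ^ n k)) atTop (𝓝 θ)) := by
  intro h
  letI : MeasurableSpace H := borel H
  haveI : BorelSpace H := ⟨rfl⟩
  have hu : ∀ g : H, (1 : H →* Matrix (Fin 1) (Fin 1) ℂ) g ∈ Matrix.unitaryGroup (Fin 1) ℂ :=
    fun g => by simp
  exact window_trivialRep_false (G := H) (N := 1) 2 (h H hH 1 1 continuous_const hu 2 le_rfl)

end Faithful

end Summit.QuantumFields.YangMills.Theorems.TunedSequenceExists.Negative.UnfaithfulFalse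

end
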